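import Summits.Ventures.LatticeQCDFlow.Scoring.SU2TorusPolyakovLoopCharacterIntegral
import Summits.Ventures.LatticeQCDFlow.Scoring.SU2TorusPlaquette
import HarnessLib

/-!
# SU(2) on the 2-torus: THE EXACT POLYAKOV LOOP `⟨½ tr P⟩ = 0` AND TWO-POINT FUNCTION `⟨½ tr P_j · ½ tr P_{j+T}⟩_{(ℤ/L)², β}`

HONEST FRAMING: exact (Metropolis-corrected) sampling algorithms for lattice gauge theory;
figures of merit are autocorrelation/cost numbers at stated couplings and volumes; no
continuum-physics claim.

Venture `LatticeQCDFlow` (cell pub-lqcd), sub-topic `Scoring`; FANOUT row 5 (`s0-sun-a`), GEN-11.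
NEW WORK of the cell (placement rule); the lead's NOT-TYPED item 'Polyakov correlators' (oracle X02's
`polyakov_loop = 0` and `polyakov_2pt`, RT-30 (146)) as THEOREMS about theory-2's Wilson measure
`wilsonMeasure (fundamentalRep (Fin 2)) β` on `(ℤ/L)²` (`β ≥ 0`).  The Polyakov line winding in direction `0`
through `(i,j)` is `P_j = h(i,j) h(i+1,j) ⋯ h(i+L−1,j)`; `c_n(β) = e^{−2β}(I_n(2β) − I_{n+2}(2β))`,
`λ_n = c_n/(n+1)`.

* **`wilson_mean_su2a0_polyakov_two`** — `⟨½ tr P_j⟩_{(ℤ/L)²,β} = 0` for every `L ≥ 1`: centre symmetry,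
  as an exact identity of the finite-volume Haar-based measure (every term of the character expansion
  vanishes, `SU2TorusPolyakovLoopCharacterIntegral.integral_su2a0_polyakov_mul_prod_su2Character`);
* **`wilson_mean_su2a0_polyakov_pair_two`** — for `L ≥ 2` and a separation `1 ≤ T ≤ L − 1`:
  `⟨½ tr P_j · ½ tr P_{j+T}⟩_{(ℤ/L)²,β} = ¼ Σ_n [λ_n^{LT} λ_{n+1}^{L²−LT} + λ_{n+1}^{LT} λ_n^{L²−LT}] / Σ_n λ_n^{L²}`
  — the two cylinders of areas `LT` and `L² − LT` glued along the two loops,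
  `Σ_{r,s} N_{r,½}^s λ_r^{A₁} λ_s^{A₂} / (d_½² Z)`; symmetric under `T ↔ L − T`, and as `L → ∞` at fixed
  `T` dominated by `¼ (λ_1/λ_0)^{LT}` (perimeter-times-length decay, the confining 2-d behaviour).

Dictionary to the cell's tables (X02): `β_table = 2β`, `⟨l(x₀) l(x₀+R)*⟩ = ⟨½ tr P_j · ½ tr P_{j+R}⟩`
(real traces); float64 evaluation of the typed series reproduces X02 (e.g. `b = 2.2`: `L = 8`, `R = 1` →
`5.41588e-4`; `L = 16`, `R = 1` → `1.17327e-6`; `L = 4`: `R = 0, 1, 2` → `0.25000, 0.011661, 0.0010832`,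
X02 T5's brute-force Metropolis `0.24997(21), 0.01172(29), 0.00085(42)`).  Nothing is cited; no `def`.
-/

noncomputable section

open Real MeasureTheory Set Function Finset Polynomial.Chebyshev
open Literature.MathematicalPhysics.QuantumFieldTheory Literature.MathematicalPhysics.QuantumLattice
open Literature.Analysis.FunctionSpaces
open Summit.Ventures.LatticeQCDFlow.Exactness
open Summit.Ventures.LatticeQCDFlow.Theory2.Lattice

namespace Summit.Ventures.LatticeQCDFlow.Scoring

variable {L : ℕ} [NeZero L]

/-! ## §1. Character expansions of the Polyakov insertions -/

omit [NeZero L] in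
/-- A row holonomy is a continuous function of the configuration. -/
theorem continuous_rowProd (i y : ZMod L) (n : ℕ) :
    Continuous fun V : GaugeConfig 2 L (Matrix.specialUnitaryGroup (Fin 2) ℂ) =>
      ((List.range n).map fun a : ℕ => V (![i + a, y], 0)).prod :=
  continuous_list_prod _ fun _ _ => continuous_apply _

/-- **A bounded measurable observable, expanded in characters** (the common form of the two insertions):
for `β ≥ 0`, measurable `g` with `|g| ≤ 1`,
`∫ g e^{−βS} dHaar^{⊗E} = Σ'_x (∏_p c_{x_p}) ∫ g ∏_p χ_{x_p}(U_p) dHaar^{⊗E}`, absolutely convergent. -/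
theorem integral_obs_mul_exp_neg_wilsonAction_eq_tsum {β : ℝ} (hβ : 0 ≤ β)
    (g : GaugeConfig 2 L (Matrix.specialUnitaryGroup (Fin 2) ℂ) → ℝ) (hgm : Measurable g) (hg : ∀ V, |g V| ≤ 1) :
    (Summable fun x : Plaquette 2 L → ℕ => (∏ p, Real.exp (-(2 * β)) *
        (besselI (x p) (2 * β) - besselI (x p + 2) (2 * β))) *
        ∫ V, g V * ∏ p : Plaquette 2 L, (U ℝ (x p)).eval (su2a0 (plaquetteHolonomy V p.1 p.2.1.1 p.2.1.2))
          ∂(Measure.pi fun _ : Edge 2 L => haarProbability (Matrix.specialUnitaryGroup (Fin 2) ℂ))) ∧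
    ∫ V, g V * Real.exp (-β * wilsonAction (fundamentalRep (Fin 2)) V)
        ∂(Measure.pi fun _ : Edge 2 L => haarProbability (Matrix.specialUnitaryGroup (Fin 2) ℂ)) =
      ∑' x : Plaquette 2 L → ℕ, (∏ p, Real.exp (-(2 * β)) *
        (besselI (x p) (2 * β) - besselI (x p + 2) (2 * β))) *
        ∫ V, g V * ∏ p : Plaquette 2 L, (U ℝ (x p)).eval (su2a0 (plaquetteHolonomy V p.1 p.2.1.1 p.2.1.2))
          ∂(Measure.pi fun _ : Edge 2 L => haarProbability (Matrix.specialUnitaryGroup (Fin 2) ℂ)) := by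
  haveI := secondCountableTopology_su2
  have ham : ∀ p : Plaquette 2 L, Measurable fun V : GaugeConfig 2 L (Matrix.specialUnitaryGroup (Fin 2) ℂ) =>
      su2a0 (plaquetteHolonomy V p.1 p.2.1.1 p.2.1.2) :=
    fun p => continuous_su2a0.measurable.comp
      (Literature.MathematicalPhysics.QuantumFieldTheory.measurable_plaquetteHolonomy p.1 p.2.1.1 p.2.1.2)
  have ha : ∀ (p : Plaquette 2 L) (V : GaugeConfig 2 L (Matrix.specialUnitaryGroup (Fin 2) ℂ)),
      su2a0 (plaquetteHolonomy V p.1 p.2.1.1 p.2.1.2) ∈ Icc (-1 : ℝ) 1 :=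
    fun p V => abs_le.mp (abs_su2a0_le_one _)
  have h := integral_mul_prod_plaqWeight_eq_tsum_fintype
    (Measure.pi fun _ : Edge 2 L => haarProbability (Matrix.specialUnitaryGroup (Fin 2) ℂ)) hβ
    (fun (p : Plaquette 2 L) (V : GaugeConfig 2 L (Matrix.specialUnitaryGroup (Fin 2) ℂ)) =>
      su2a0 (plaquetteHolonomy V p.1 p.2.1.1 p.2.1.2)) ham ha g hgm hg
  refine ⟨h.1, ?_⟩
  rw [← h.2]
  refine integral_congr_ae (Filter.Eventually.of_forall fun V => ?_)
  beta_reduce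
  rw [exp_neg_mul_wilsonAction_su2 β V]

/-! ## §2. One Polyakov line: centre symmetry -/

/-- **`⟨½ tr P_j⟩ = 0` EXACTLY.**  For every `L ≥ 1`, `β ≥ 0` and base point `(i,j)`, under theory-2's
Wilson measure on `(ℤ/L)²` the half-trace of the Polyakov line `P_j = h(i,j)⋯h(i+L−1,j)` has expectation
zero: every term of its character expansion vanishes (centre symmetry of the finite-volume measure). -/
theorem wilson_mean_su2a0_polyakov_two {β : ℝ} (hβ : 0 ≤ β) (i j : ZMod L) :
    ∫ V, su2a0 (((List.range L).map fun a : ℕ => V (![i + a, j], 0)).prod)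
        ∂(wilsonMeasure (d := 2) (L := L) (fundamentalRep (Fin 2)) β) = 0 := by
  haveI := secondCountableTopology_su2
  rw [integral_wilsonMeasure_su2_eq_div,
    (integral_obs_mul_exp_neg_wilsonAction_eq_tsum hβ
      (fun V : GaugeConfig 2 L (Matrix.specialUnitaryGroup (Fin 2) ℂ) =>
        su2a0 (((List.range L).map fun a : ℕ => V (![i + (a : ZMod L), j], 0)).prod))
      (continuous_su2a0.comp (continuous_rowProd i j L)).measurable (fun V => abs_su2a0_le_one _)).2]
  have hterm : ∀ x : Plaquette 2 L → ℕ,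
      (∏ p, Real.exp (-(2 * β)) * (besselI (x p) (2 * β) - besselI (x p + 2) (2 * β))) *
        ∫ V, su2a0 (((List.range L).map fun a : ℕ => V (![i + a, j], 0)).prod) *
          ∏ p : Plaquette 2 L, (U ℝ (x p)).eval (su2a0 (plaquetteHolonomy V p.1 p.2.1.1 p.2.1.2))
          ∂(Measure.pi fun _ : Edge 2 L => haarProbability (Matrix.specialUnitaryGroup (Fin 2) ℂ)) = 0 := by
    intro x
    have hint : (fun V : GaugeConfig 2 L (Matrix.specialUnitaryGroup (Fin 2) ℂ) =>
        su2a0 (((List.range L).map fun a : ℕ => V (![i + a, j], 0)).prod) *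
          ∏ p : Plaquette 2 L, (U ℝ (x p)).eval (su2a0 (plaquetteHolonomy V p.1 p.2.1.1 p.2.1.2))) =
        fun V => su2a0 (((List.range L).map fun a : ℕ => V (![i + a, j], 0)).prod) *
          ∏ s : Site 2 L, (U ℝ ((fun s : Site 2 L => x (s, ⟨((0 : Fin 2), (1 : Fin 2)), by decide⟩)) s)).eval
            (su2a0 (plaquetteHolonomy V s 0 1)) := by
      funext V
      rw [prod_plaquette_two]
    rw [hint, integral_su2a0_polyakov_mul_prod_su2Character, mul_zero]
  simp_rw [hterm]
  rw [tsum_zero, zero_div]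

/-! ## §3. The pair insertion as a series over `ℕ` -/

omit [NeZero L] in
/-- The pair observable `½ tr P_j · ½ tr P_{j+T}` is continuous in the configuration. -/
theorem continuous_polyakov_pair (i j : ZMod L) (T : ℕ) :
    Continuous fun V : GaugeConfig 2 L (Matrix.specialUnitaryGroup (Fin 2) ℂ) =>
      su2a0 (((List.range L).map fun a : ℕ => V (![i + a, j], 0)).prod) *
        su2a0 (((List.range L).map fun a : ℕ => V (![i + a, j + T], 0)).prod) :=
  (continuous_su2a0.comp (continuous_rowProd i j L)).mul (continuous_su2a0.comp (continuous_rowProd i _ L))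

/-- **`∫ ½tr P_j · ½tr P_{j+T} · e^{−βS} dHaar^{⊗E} = ¼ Σ_n [λ_n^{LT} λ_{n+1}^{L²−LT} + λ_{n+1}^{LT} λ_n^{L²−LT}]`**
(`β ≥ 0`, `1 ≤ T ≤ L − 1`, `λ_n = c_n/(n+1)`), as a `HasSum`: only the assignments '`n` between the loops,
`n + 1` outside' and '`n + 1` between, `n` outside' contribute. -/
theorem hasSum_integral_polyakov_pair_mul_exp_neg_wilsonAction_two {β : ℝ} (hβ : 0 ≤ β) (i j : ZMod L)
    {T : ℕ} (hT : 1 ≤ T) (hTL : T + 1 ≤ L) :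
    HasSum (fun n : ℕ => (1 / 4 : ℝ) *
        ((Real.exp (-(2 * β)) * (besselI n (2 * β) - besselI (n + 2) (2 * β)) / ((n : ℝ) + 1)) ^ (L * T) *
            (Real.exp (-(2 * β)) * (besselI (n + 1) (2 * β) - besselI (n + 1 + 2) (2 * β)) / ((n : ℝ) + 2)) ^
              (L ^ 2 - L * T) +
          (Real.exp (-(2 * β)) * (besselI (n + 1) (2 * β) - besselI (n + 1 + 2) (2 * β)) / ((n : ℝ) + 2)) ^
              (L * T) *
            (Real.exp (-(2 * β)) * (besselI n (2 * β) - besselI (n + 2) (2 * β)) / ((n : ℝ) + 1)) ^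
              (L ^ 2 - L * T)))
      (∫ V, su2a0 (((List.range L).map fun a : ℕ => V (![i + a, j], 0)).prod) *
          su2a0 (((List.range L).map fun a : ℕ => V (![i + a, j + T], 0)).prod) *
        Real.exp (-β * wilsonAction (fundamentalRep (Fin 2)) V)
        ∂(Measure.pi fun _ : Edge 2 L => haarProbability (Matrix.specialUnitaryGroup (Fin 2) ℂ))) := by
  haveI := secondCountableTopology_su2
  have hTL' : T < L := by omega
  obtain ⟨hsum, hN⟩ := integral_obs_mul_exp_neg_wilsonAction_eq_tsum (L := L) hβ
    (fun V : GaugeConfig 2 L (Matrix.specialUnitaryGroup (Fin 2) ℂ) =>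
      su2a0 (((List.range L).map fun a : ℕ => V (![i + (a : ZMod L), j], 0)).prod) *
        su2a0 (((List.range L).map fun a : ℕ => V (![i + (a : ZMod L), j + (T : ZMod L)], 0)).prod))
    (continuous_polyakov_pair i j T).measurable
    (fun V => by
      rw [abs_mul]
      exact mul_le_one₀ (abs_su2a0_le_one _) (abs_nonneg _) (abs_su2a0_le_one _))
  -- abbreviations
  set pl : {p : Fin 2 × Fin 2 // p.1 < p.2} := ⟨((0 : Fin 2), (1 : Fin 2)), by decide⟩ with hpl
  set A := (range L ×ˢ range T).image (fun q : ℕ × ℕ => (![i + q.1, j + q.2] : Site 2 L)) with hA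
  set A' := (range L ×ˢ range (L - T)).image
    (fun q : ℕ × ℕ => (![i + q.1, j + T + q.2] : Site 2 L)) with hA'
  have hA'c : A' = Aᶜ := annulusSites_compl i j hTL'.le
  set p₀ : Plaquette 2 L := (![i, j], pl) with hp₀
  set p₁ : Plaquette 2 L := (![i, j + T], pl) with hp₁
  set c : ℕ → ℝ := fun n => Real.exp (-(2 * β)) * (besselI n (2 * β) - besselI (n + 2) (2 * β)) with hc
  have hc0 : ∀ n, 0 ≤ c n := fun n => charCoeff_nonneg hβ n
  have hcorner : (![i, j] : Site 2 L) ∈ A := by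
    have := mem_rect i j (R := L) (T := T) (a := 0) (b := 0) (by omega) (by omega)
    rwa [Nat.cast_zero, add_zero, add_zero] at this
  have hmemA' : ∀ a < L, ∀ b < L - T, (![i + a, j + T + b] : Site 2 L) ∉ A := by
    intro a ha b hb
    rw [← Finset.mem_compl, ← hA'c]
    exact mem_rect i (j + T) ha hb
  have hcorner' : (![i, j + T] : Site 2 L) ∉ A := by
    have := hmemA' 0 (by omega) 0 (by omega)
    rwa [Nat.cast_zero, add_zero, add_zero] at this
  -- membership gives the coordinates
  have hmemA : ∀ {s : Site 2 L}, s ∈ A → ∃ a b : ℕ, a < L ∧ b < T ∧ s = ![i + a, j + b] := by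
    intro s hs
    obtain ⟨q, hq, rfl⟩ := Finset.mem_image.mp hs
    rw [Finset.mem_product, Finset.mem_range, Finset.mem_range] at hq
    exact ⟨q.1, q.2, hq.1, hq.2, rfl⟩
  have hmemAc : ∀ {s : Site 2 L}, s ∉ A → ∃ a b : ℕ, a < L ∧ b < L - T ∧ s = ![i + a, j + T + b] := by
    intro s hs
    rw [← Finset.mem_compl, ← hA'c] at hs
    obtain ⟨q, hq, rfl⟩ := Finset.mem_image.mp hs
    rw [Finset.mem_product, Finset.mem_range, Finset.mem_range] at hq
    exact ⟨q.1, q.2, hq.1, hq.2, rfl⟩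
  -- the two surviving families of terms
  set Tp : (Plaquette 2 L → ℕ) → ℝ := fun x => (∏ p, c (x p)) *
    (if (∀ a < L, ∀ b < T, x (![i + a, j + b], pl) = x p₀) then
      if (∀ a < L, ∀ b < L - T, x (![i + a, j + T + b], pl) = x p₁) then
        ((((x p₀ : ℝ) + 1) ^ (L * T)))⁻¹ * (((((x p₁ : ℝ) + 1) ^ (L * (L - T))))⁻¹ *
          ((1 / 4) * (if x p₁ = x p₀ + 1 then (1 : ℝ) else 0)))
      else 0
     else 0) with hTp
  set Tm : (Plaquette 2 L → ℕ) → ℝ := fun x => (∏ p, c (x p)) *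
    (if (∀ a < L, ∀ b < T, x (![i + a, j + b], pl) = x p₀) then
      if (∀ a < L, ∀ b < L - T, x (![i + a, j + T + b], pl) = x p₁) then
        ((((x p₀ : ℝ) + 1) ^ (L * T)))⁻¹ * (((((x p₁ : ℝ) + 1) ^ (L * (L - T))))⁻¹ *
          ((1 / 4) * (if x p₀ = 0 then (0 : ℝ) else if x p₁ = x p₀ - 1 then 1 else 0)))
      else 0
     else 0) with hTm
  have hT : ∀ x : Plaquette 2 L → ℕ,
      (∏ p, Real.exp (-(2 * β)) * (besselI (x p) (2 * β) - besselI (x p + 2) (2 * β))) *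
      ∫ V, su2a0 (((List.range L).map fun a : ℕ => V (![i + (a : ZMod L), j], 0)).prod) *
          su2a0 (((List.range L).map fun a : ℕ => V (![i + (a : ZMod L), j + (T : ZMod L)], 0)).prod) *
        ∏ p : Plaquette 2 L, (U ℝ (x p)).eval (su2a0 (plaquetteHolonomy V p.1 p.2.1.1 p.2.1.2))
        ∂(Measure.pi fun _ : Edge 2 L => haarProbability (Matrix.specialUnitaryGroup (Fin 2) ℂ)) =
      Tp x + Tm x := by
    intro x
    have hint : (fun V : GaugeConfig 2 L (Matrix.specialUnitaryGroup (Fin 2) ℂ) =>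
        su2a0 (((List.range L).map fun a : ℕ => V (![i + (a : ZMod L), j], 0)).prod) *
          su2a0 (((List.range L).map fun a : ℕ => V (![i + (a : ZMod L), j + (T : ZMod L)], 0)).prod) *
        ∏ p : Plaquette 2 L, (U ℝ (x p)).eval (su2a0 (plaquetteHolonomy V p.1 p.2.1.1 p.2.1.2))) =
        fun V => su2a0 (((List.range L).map fun a : ℕ => V (![i + (a : ZMod L), j], 0)).prod) *
          su2a0 (((List.range L).map fun a : ℕ => V (![i + (a : ZMod L), j + (T : ZMod L)], 0)).prod) *
          ∏ s : Site 2 L, (U ℝ ((fun s : Site 2 L => x (s, pl)) s)).eval (su2a0 (plaquetteHolonomy V s 0 1)) := by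
      funext V
      rw [prod_plaquette_two]
    rw [hint, integral_su2a0_polyakov_pair_mul_prod_su2Character i j hT hTL]
    simp only [← hp₀, ← hp₁]
    rw [hTp, hTm, hc]
    simp only
    split_ifs <;> first | (exfalso; omega) | ring
  simp_rw [hT] at hsum hN
  have hprod0 : ∀ x : Plaquette 2 L → ℕ, 0 ≤ ∏ p, c (x p) := fun x => Finset.prod_nonneg fun p _ => hc0 _
  have hTp0 : ∀ x, 0 ≤ Tp x := by
    intro x
    rw [hTp]
    refine mul_nonneg (hprod0 x) ?_
    split_ifs <;> positivity
  have hTm0 : ∀ x, 0 ≤ Tm x := by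
    intro x
    rw [hTm]
    refine mul_nonneg (hprod0 x) ?_
    split_ifs <;> positivity
  have hTps : Summable Tp :=
    Summable.of_nonneg_of_le hTp0 (fun x => le_add_of_nonneg_right (hTm0 x)) hsum
  have hTms : Summable Tm :=
    Summable.of_nonneg_of_le hTm0 (fun x => le_add_of_nonneg_left (hTp0 x)) hsum
  -- the surviving assignments
  set g₁ : ℕ → (Plaquette 2 L → ℕ) := fun n p => if p.1 ∈ A then n else n + 1 with hg₁
  set g₂ : ℕ → (Plaquette 2 L → ℕ) := fun n p => if p.1 ∈ A then n + 1 else n with hg₂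
  have hg₁p₀ : ∀ n, g₁ n p₀ = n := fun n => by simp only [hg₁, hp₀]; exact if_pos hcorner
  have hg₂p₀ : ∀ n, g₂ n p₀ = n + 1 := fun n => by simp only [hg₂, hp₀]; exact if_pos hcorner
  have hg₁p₁ : ∀ n, g₁ n p₁ = n + 1 := fun n => by simp only [hg₁, hp₁]; exact if_neg hcorner'
  have hg₂p₁ : ∀ n, g₂ n p₁ = n := fun n => by simp only [hg₂, hp₁]; exact if_neg hcorner'
  have hg₁inj : Injective g₁ := fun n n' h => by
    have := congrFun h p₀
    rwa [hg₁p₀, hg₁p₀] at this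
  have hg₂inj : Injective g₂ := fun n n' h => by
    have := congrFun h p₁
    rwa [hg₂p₁, hg₂p₁] at this
  have hsuppTp : support Tp ⊆ Set.range g₁ := by
    intro x hx
    rw [mem_support, hTp] at hx
    simp only at hx
    have hC1 : ∀ a < L, ∀ b < T, x (![i + a, j + b], pl) = x p₀ := by
      by_contra h; rw [if_neg h, mul_zero] at hx; exact hx rfl
    rw [if_pos hC1] at hx
    have hC2 : ∀ a < L, ∀ b < L - T, x (![i + a, j + T + b], pl) = x p₁ := by
      by_contra h; rw [if_neg h, mul_zero] at hx; exact hx rfl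
    rw [if_pos hC2] at hx
    have h01 : x p₁ = x p₀ + 1 := by
      by_contra h; rw [if_neg h, mul_zero, mul_zero, mul_zero, mul_zero] at hx; exact hx rfl
    refine ⟨x p₀, funext fun p => ?_⟩
    rw [plaquette_two_eq p, hg₁]
    by_cases hp : p.1 ∈ A
    · simp only [if_pos hp]
      obtain ⟨a, b, ha, hb, h1⟩ := hmemA hp
      rw [h1]
      exact (hC1 a ha b hb).symm
    · simp only [if_neg hp]
      obtain ⟨a, b, ha, hb, h1⟩ := hmemAc hp
      rw [h1, ← h01]
      exact (hC2 a ha b hb).symm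
  have hsuppTm : support Tm ⊆ Set.range g₂ := by
    intro x hx
    rw [mem_support, hTm] at hx
    simp only at hx
    have hC1 : ∀ a < L, ∀ b < T, x (![i + a, j + b], pl) = x p₀ := by
      by_contra h; rw [if_neg h, mul_zero] at hx; exact hx rfl
    rw [if_pos hC1] at hx
    have hC2 : ∀ a < L, ∀ b < L - T, x (![i + a, j + T + b], pl) = x p₁ := by
      by_contra h; rw [if_neg h, mul_zero] at hx; exact hx rfl
    rw [if_pos hC2] at hx
    have h0 : x p₀ ≠ 0 := by
      intro h; rw [if_pos h, mul_zero, mul_zero, mul_zero, mul_zero] at hx; exact hx rfl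
    rw [if_neg h0] at hx
    have h01 : x p₁ = x p₀ - 1 := by
      by_contra h; rw [if_neg h, mul_zero, mul_zero, mul_zero, mul_zero] at hx; exact hx rfl
    refine ⟨x p₁, funext fun p => ?_⟩
    rw [plaquette_two_eq p, hg₂]
    by_cases hp : p.1 ∈ A
    · simp only [if_pos hp]
      obtain ⟨a, b, ha, hb, h1⟩ := hmemA hp
      rw [h1, hC1 a ha b hb]
      omega
    · simp only [if_neg hp]
      obtain ⟨a, b, ha, hb, h1⟩ := hmemAc hp
      rw [h1]
      exact (hC2 a ha b hb).symm
  -- the values on the surviving assignments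
  have hpow : L * (L - T) = L ^ 2 - L * T := by rw [mul_tsub, sq]
  have hg₁in : ∀ n, ∀ a < L, ∀ b < T, g₁ n (![i + a, j + b], pl) = g₁ n p₀ := by
    intro n a ha b hb
    rw [hg₁p₀]; simp only [hg₁]; exact if_pos (mem_rect i j ha hb)
  have hg₂in : ∀ n, ∀ a < L, ∀ b < T, g₂ n (![i + a, j + b], pl) = g₂ n p₀ := by
    intro n a ha b hb
    rw [hg₂p₀]; simp only [hg₂]; exact if_pos (mem_rect i j ha hb)
  have hg₁out : ∀ n, ∀ a < L, ∀ b < L - T, g₁ n (![i + a, j + T + b], pl) = g₁ n p₁ := by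
    intro n a ha b hb
    rw [hg₁p₁]; simp only [hg₁]; exact if_neg (hmemA' a ha b hb)
  have hg₂out : ∀ n, ∀ a < L, ∀ b < L - T, g₂ n (![i + a, j + T + b], pl) = g₂ n p₁ := by
    intro n a ha b hb
    rw [hg₂p₁]; simp only [hg₂]; exact if_neg (hmemA' a ha b hb)
  have hTpg : ∀ n : ℕ, Tp (g₁ n) = (1 / 4) * ((c n / ((n : ℝ) + 1)) ^ (L * T) *
      (c (n + 1) / ((n : ℝ) + 2)) ^ (L ^ 2 - L * T)) := by
    intro n
    rw [hTp]
    simp only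
    rw [if_pos (hg₁in n), if_pos (hg₁out n), hg₁p₀, hg₁p₁, if_pos rfl, hpow,
      show (∏ p, c (g₁ n p)) = c n ^ (L * T) * c (n + 1) ^ (L ^ 2 - L * T) from
        prod_rect_piecewise c i j le_rfl hTL'.le n (n + 1), div_pow, div_pow]
    push_cast
    ring
  have hTmg : ∀ n : ℕ, Tm (g₂ n) = (1 / 4) * ((c (n + 1) / ((n : ℝ) + 2)) ^ (L * T) *
      (c n / ((n : ℝ) + 1)) ^ (L ^ 2 - L * T)) := by
    intro n
    rw [hTm]
    simp only
    rw [if_pos (hg₂in n), if_pos (hg₂out n), hg₂p₀, hg₂p₁, if_neg (Nat.succ_ne_zero n), Nat.add_sub_cancel,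
      if_pos rfl, hpow,
      show (∏ p, c (g₂ n p)) = c (n + 1) ^ (L * T) * c n ^ (L ^ 2 - L * T) from
        prod_rect_piecewise c i j le_rfl hTL'.le (n + 1) n, div_pow, div_pow]
    push_cast
    ring
  -- assemble
  have h1 : HasSum (Tp ∘ g₁) (∑' x, Tp x) := by
    rw [← hg₁inj.tsum_eq hsuppTp]
    exact (hTps.comp_injective hg₁inj).hasSum
  have h2 : HasSum (Tm ∘ g₂) (∑' x, Tm x) := by
    rw [← hg₂inj.tsum_eq hsuppTm]
    exact (hTms.comp_injective hg₂inj).hasSum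
  have h12 := h1.add h2
  rw [← hTps.tsum_add hTms, ← hN] at h12
  refine h12.congr_fun fun n => ?_
  simp only [Function.comp_apply, hTpg, hTmg, hc]
  ring

/-! ## §4. The exact Polyakov-loop two-point function -/

/-- **THE EXACT SU(2) POLYAKOV-LOOP TWO-POINT FUNCTION ON THE 2-TORUS.**  For every `L ≥ 2`, `β ≥ 0`,
base point `(i,j)` and separation `1 ≤ T ≤ L − 1`, under theory-2's Wilson measure
`wilsonMeasure (fundamentalRep (Fin 2)) β` on `(ℤ/L)²`:
`⟨½ tr P_j · ½ tr P_{j+T}⟩ = ¼ Σ_n [λ_n^{LT} λ_{n+1}^{L²−LT} + λ_{n+1}^{LT} λ_n^{L²−LT}] / Σ_n λ_n^{L²}`,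
`λ_n = c_n/(n+1)`, `c_n = e^{−2β}(I_n(2β) − I_{n+2}(2β))` — the two cylinders between the loops,
`Σ_{r,s} N_{r,½}^s λ_r^{LT} λ_s^{L²−LT}/(4Z)`, now a theorem about the Haar-based lattice measure. -/
theorem wilson_mean_su2a0_polyakov_pair_two {β : ℝ} (hβ : 0 ≤ β) (i j : ZMod L) {T : ℕ} (hT : 1 ≤ T)
    (hTL : T + 1 ≤ L) :
    ∫ V, su2a0 (((List.range L).map fun a : ℕ => V (![i + a, j], 0)).prod) *
          su2a0 (((List.range L).map fun a : ℕ => V (![i + a, j + T], 0)).prod)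
        ∂(wilsonMeasure (d := 2) (L := L) (fundamentalRep (Fin 2)) β) =
      (∑' n : ℕ, (1 / 4 : ℝ) *
        ((Real.exp (-(2 * β)) * (besselI n (2 * β) - besselI (n + 2) (2 * β)) / ((n : ℝ) + 1)) ^ (L * T) *
            (Real.exp (-(2 * β)) * (besselI (n + 1) (2 * β) - besselI (n + 1 + 2) (2 * β)) / ((n : ℝ) + 2)) ^
              (L ^ 2 - L * T) +
          (Real.exp (-(2 * β)) * (besselI (n + 1) (2 * β) - besselI (n + 1 + 2) (2 * β)) / ((n : ℝ) + 2)) ^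
              (L * T) *
            (Real.exp (-(2 * β)) * (besselI n (2 * β) - besselI (n + 2) (2 * β)) / ((n : ℝ) + 1)) ^
              (L ^ 2 - L * T))) /
      ∑' n : ℕ, (Real.exp (-(2 * β)) * (besselI n (2 * β) - besselI (n + 2) (2 * β)) /
        ((n : ℝ) + 1)) ^ (L ^ 2) := by
  rw [integral_wilsonMeasure_su2_eq_div,
    ← (hasSum_integral_polyakov_pair_mul_exp_neg_wilsonAction_two hβ i j hT hTL).tsum_eq,
    partitionFunction_su2_two_toReal_eq_tsum hβ]

end Summit.Ventures.LatticeQCDFlow.Scoring
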